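import Summits.BirchSwinnertonDyer.Rank1Residual.Supersingular.BlindPointFlatTwo
import HarnessLib

/-!
# D-imc-71W (Wα): the LEVEL-`m` CERTIFICATE for `L♭(−2) ≠ 0` (cell `bsd-f1-sign2`, seat `-imc` g28)

Crux workfile for `SupersingularRankZeroAtTwo` (stmt-19097), line `odd_blind_package`, stub `stub_CD`
(CDF).  Pure consequences of the tree's (V)/(D) identities for a Sprung pair at the blind point `T = −2`
(`BlindPointFlatTwo.evalAt_and_derivAt_of_isSprungPair`, [Sprung2017] Cor. 4.4):

* `sharp_evalAt_neg_two_coe` — level 1 reads the `♯` value: `L♯(−2) = −θ₁(−2)` (`c₁ = 1`); so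
  `θ₁(−2) = 0` (e.g. `w(E ⊗ χ₈) = −1`) gives `L♯(−2) = 0` (`sharp_evalAt_neg_two_eq_zero`).
* `exists_derivAt_add_eSeq_mul_flat` — at a level `m ≥ 1` with `c_m = 0` and `d_m · L♯(−2) = 0`:
  `Θ_m′(−2) + e_m · L♭(−2) ∈ 2^m ℤ₂` — the blind value is READ OFF the derivative of ONE Mazur–Tate
  element (no elimination between levels, no Teichmüller exponent `c`).
* `flat_evalAt_neg_two_ne_zero_of_level` — **the certificate**: if moreover `θ_m′(−2) ∉ 2^m ℤ₂`
  (an exact rational datum), then `L♭(−2) ≠ 0`.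
* `sharpPoly_zero_two_mul`, `cSeq_zero_two_mul`, `dSeq_zero_two_mul` — at `a₂ = 0` every EVEN level is
  admissible unconditionally (`u_{2k} = 0`), whence `flat_evalAt_neg_two_ne_zero_of_even_level` (any root
  number) and the exact DIVISIBILITY LAW `two_pow_dvd_of_flat_evalAt_eq_zero` (`L♭(−2) = 0 ⇒ 2^{2k} ∣ θ_{2k}′(−2)`),
  which combined with the tree's blind law `flatLaw_evalAt_neg_two_of_rootNumber` says: at `a₂ = 0` and
  `w(W)·χ₈(N) = +1`, `θ_{2k}′(−2) ∈ 2^{2k}ℤ₂` for every `k ≥ 1`.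

DATA (exact, this session, `-an` g41 `theta53` Mazur–Tate vectors = PARI `msfromell`, 1209 classes,
levels `n ≤ 8`; engine symbols calibrated to the integral normalisation by `λ = 2/c_∞` — validated by
1271/1271 cross-level consistencies of the `♭` readings and by the `a₂ = 0`, `w·χ₈(N) = +1` divisibility law
on 264 classes × 4 even levels, which holds to the last bit after calibration and fails 293 times before):
`θ_n(−2) = 0` at EVERY level on all 661 `w·χ₈(N) = −1` classes ((V): `c_n L♯(−2) = 0`); `L♭(−2) ≠ 0`
certified at some level `m ≤ 8` on 649/661 of them after the calibration `λ = 2/c_∞` (634/661 with one FURTHER bit of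
margin after calibration — v2 correction, REF1 §408 R408a: the earlier «645» was the raw-convention `v₂ < m − 1` count); smallest-conductor
(Wα) witnesses with `r₂ = rank E⊗χ₈ = 1`: `19a1` (`a₂ = 0`, `m = 2`: calibrated `θ₂′(−2) = −1/3`, so
`L♭(−2) ≡ −1/3 (mod 4)`, a unit), `67a1` (`a₂ = +2`, `m = 4`: `θ₄′(−2) = 118`, `L♭(−2) ≡ 59 (mod 8)`),
`11a1` (`a₂ = −2`, `m = 4`: `θ₄′(−2) = 114/5`, `L♭(−2) ≡ 57/5 (mod 8)`); the one rank-3 twist class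
`8961b1` reads `θ₇′(−2) = θ₈′(−2) = 0` (`L♭(−2) ≡ 0 mod 2⁵`), as the corank trichotomy `|r₂ − 1| = 2` predicts.
A Lean INSTANCE needs the values of the tree's `mazurTateElement f 2 m` for the curve (a computation
record), not supplied here.  THEOREMS ONLY; nothing about BSD is asserted.
-/

set_option autoImplicit false

noncomputable section

open scoped Classical

open Polynomial Literature.NumberTheory.EllipticCurves Literature.NumberTheory.EllipticCurves.ModularForms
  Literature.NumberTheory.EllipticCurves.Sprung2017

namespace Summit.BirchSwinnertonDyer.Rank1Residual.Supersingular

namespace BlindFlat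

namespace ImcG28

open BlindLever

/-! ## §1. `a₂ = 0`: the even `♯`-polynomials vanish -/

/-- `u_{2k} = 0` at `a_p = 0` (`u_{n+2} = a_p u_{n+1} − Φ u_n`, `u_0 = 0`). [cite: Sprung2017, Cor. 4.4] -/
theorem sharpPoly_zero_two_mul (p k : ℕ) : sharpPoly 0 p (2 * k) = 0 := by
  induction k with
  | zero => simp
  | succ k ih =>
    rw [show 2 * (k + 1) = 2 * k + 2 by ring, sharpPoly_add_two, ih, mul_zero, sub_zero, map_zero,
      zero_mul]

/-- `c_{2k} = u_{2k}(−2) = 0` at `a₂ = 0`. [folklore] -/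
theorem cSeq_zero_two_mul (k : ℕ) : cSeq 0 (2 * k) = 0 := by
  simp [cSeq, sharpPoly_zero_two_mul]

/-- `d_{2k} = u_{2k}′(−2) = 0` at `a₂ = 0`. [folklore] -/
theorem dSeq_zero_two_mul (k : ℕ) : dSeq 0 (2 * k) = 0 := by
  simp [dSeq, sharpPoly_zero_two_mul]

/-! ## §2. Level readings of the `♯` value and of the blind `♭` value -/

variable {N : ℕ} [NeZero N] {f : CuspForm (CongruenceSubgroup.Gamma0 N) 2}

omit [NeZero N] in
/-- **Level 1 reads `L♯(−2)`**: `L♯(−2) = −θ₁(−2)` in `ℚ₂` (from (V) with `c₁ = 1`).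
[cite: Sprung2017, Cor. 4.4] -/
theorem sharp_evalAt_neg_two_coe {a : ℤ} {Ls Lf : IwasawaAlgebra 2} (hSP : IsSprungPair f 2 a Ls Lf)
    {Θ : ℤ_[2][X]}
    (hΘ : Θ.map (algebraMap ℤ_[2] ℚ_[2]) = (mazurTateElement f 2 1).map (algebraMap ℚ ℚ_[2])) :
    ((evalAt (-2 : ℤ_[2]) Ls : ℤ_[2]) : ℚ_[2]) = -(((mazurTateElement f 2 1).eval (-2) : ℚ) : ℚ_[2]) := by
  have hV := (evalAt_and_derivAt_of_isSprungPair hSP (n := 1) le_rfl hΘ).1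
  rw [cSeq_one, Int.cast_one, neg_mul, one_mul] at hV
  have hA := coe_evalAt_eq_of_map_eq hΘ
  rw [hV] at hA
  push_cast at hA
  linear_combination -hA

omit [NeZero N] in
/-- If `θ₁(−2) = 0` (e.g. `L(E, χ₈, 1) = 0`, as when `w(E ⊗ χ₈) = −1`), then `L♯(−2) = 0`.
[cite: Sprung2017, Cor. 4.4] -/
theorem sharp_evalAt_neg_two_eq_zero {a : ℤ} {Ls Lf : IwasawaAlgebra 2} (hSP : IsSprungPair f 2 a Ls Lf)
    {Θ : ℤ_[2][X]}
    (hΘ : Θ.map (algebraMap ℤ_[2] ℚ_[2]) = (mazurTateElement f 2 1).map (algebraMap ℚ ℚ_[2]))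
    (h0 : (mazurTateElement f 2 1).eval (-2) = 0) : evalAt (-2 : ℤ_[2]) Ls = 0 := by
  have h := sharp_evalAt_neg_two_coe hSP hΘ
  rw [h0, Rat.cast_zero, neg_zero] at h
  have h' : ((evalAt (-2 : ℤ_[2]) Ls : ℤ_[2]) : ℚ_[2]) = ((0 : ℤ_[2]) : ℚ_[2]) := by rw [h]; norm_cast
  exact Subtype.ext h'

omit [NeZero N] in
/-- **One-level reading of the blind value.**  At a level `m ≥ 1` with `c_m = 0` and
`d_m · L♯(−2) = 0`: `Θ_m′(−2) + e_m · L♭(−2) = 2^m · ρ` for some `ρ ∈ ℤ₂`. [cite: Sprung2017, Cor. 4.4] -/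
theorem exists_derivAt_add_eSeq_mul_flat {a : ℤ} {Ls Lf : IwasawaAlgebra 2}
    (hSP : IsSprungPair f 2 a Ls Lf) {m : ℕ} (hm : 1 ≤ m) (hc : cSeq a m = 0)
    (hdS : ((dSeq a m : ℤ) : ℤ_[2]) * evalAt (-2 : ℤ_[2]) Ls = 0) {Θ : ℤ_[2][X]}
    (hΘ : Θ.map (algebraMap ℤ_[2] ℚ_[2]) = (mazurTateElement f 2 m).map (algebraMap ℚ ℚ_[2])) :
    ∃ ρ : ℤ_[2], derivAt (-2 : ℤ_[2]) (Θ : PowerSeries ℤ_[2]) +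
      ((eSeq a m : ℤ) : ℤ_[2]) * evalAt (-2 : ℤ_[2]) Lf = 2 ^ m * ρ := by
  obtain ⟨ρ, hρ⟩ := (evalAt_and_derivAt_of_isSprungPair hSP hm hΘ).2
  rw [hc, Int.cast_zero, zero_mul, add_zero, hdS, add_zero] at hρ
  exact ⟨ρ, hρ⟩

omit [NeZero N] in
/-- **The level-`m` certificate (Wα).**  At a level `m ≥ 1` with `c_m = 0` and `d_m · L♯(−2) = 0`,
if the exact rational `θ_m′(−2)` is NOT in `2^m ℤ₂`, then `L♭(−2) ≠ 0`. [cite: Sprung2017, Cor. 4.4] -/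
theorem flat_evalAt_neg_two_ne_zero_of_level {a : ℤ} {Ls Lf : IwasawaAlgebra 2}
    (hSP : IsSprungPair f 2 a Ls Lf) {m : ℕ} (hm : 1 ≤ m) (hc : cSeq a m = 0)
    (hdS : ((dSeq a m : ℤ) : ℤ_[2]) * evalAt (-2 : ℤ_[2]) Ls = 0) {Θ : ℤ_[2][X]}
    (hΘ : Θ.map (algebraMap ℤ_[2] ℚ_[2]) = (mazurTateElement f 2 m).map (algebraMap ℚ ℚ_[2]))
    (hcert : ∀ ρ : ℤ_[2],
      (((derivative (mazurTateElement f 2 m)).eval (-2) : ℚ) : ℚ_[2]) ≠ ((2 ^ m * ρ : ℤ_[2]) : ℚ_[2])) :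
    evalAt (-2 : ℤ_[2]) Lf ≠ 0 := by
  intro hF
  obtain ⟨ρ, hρ⟩ := exists_derivAt_add_eSeq_mul_flat hSP hm hc hdS hΘ
  rw [hF, mul_zero, add_zero] at hρ
  have hP := coe_derivAt_eq_of_map_eq hΘ
  rw [hρ] at hP
  exact hcert ρ hP.symm

omit [NeZero N] in
/-- **`a₂ = 0`: every even level certifies, for ANY root number.**  If `θ_{2k}′(−2) ∉ 2^{2k} ℤ₂` for some
`k ≥ 1`, then `L♭(−2) ≠ 0`. [cite: Sprung2017, Thm. 1.12, Cor. 4.4] -/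
theorem flat_evalAt_neg_two_ne_zero_of_even_level {Ls Lf : IwasawaAlgebra 2}
    (hSP : IsSprungPair f 2 0 Ls Lf) {k : ℕ} (hk : 1 ≤ k) {Θ : ℤ_[2][X]}
    (hΘ : Θ.map (algebraMap ℤ_[2] ℚ_[2]) = (mazurTateElement f 2 (2 * k)).map (algebraMap ℚ ℚ_[2]))
    (hcert : ∀ ρ : ℤ_[2], (((derivative (mazurTateElement f 2 (2 * k))).eval (-2) : ℚ) : ℚ_[2]) ≠
      ((2 ^ (2 * k) * ρ : ℤ_[2]) : ℚ_[2])) :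
    evalAt (-2 : ℤ_[2]) Lf ≠ 0 :=
  flat_evalAt_neg_two_ne_zero_of_level hSP (by omega) (cSeq_zero_two_mul k)
    (by rw [dSeq_zero_two_mul, Int.cast_zero, zero_mul]) hΘ hcert

omit [NeZero N] in
/-- **`a₂ = 0`: the exact divisibility law.**  If `L♭(−2) = 0` (e.g. by the blind law at
`w·χ₈(N) = +1`, tree `flatLaw_evalAt_neg_two_of_rootNumber`), then `θ_{2k}′(−2) ∈ 2^{2k} ℤ₂` for every
`k ≥ 1`. [cite: Sprung2017, Thm. 1.12, Cor. 4.4] -/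
theorem two_pow_dvd_of_flat_evalAt_eq_zero {Ls Lf : IwasawaAlgebra 2}
    (hSP : IsSprungPair f 2 0 Ls Lf) (hF : evalAt (-2 : ℤ_[2]) Lf = 0) {k : ℕ} (hk : 1 ≤ k) {Θ : ℤ_[2][X]}
    (hΘ : Θ.map (algebraMap ℤ_[2] ℚ_[2]) = (mazurTateElement f 2 (2 * k)).map (algebraMap ℚ ℚ_[2])) :
    ∃ ρ : ℤ_[2], (((derivative (mazurTateElement f 2 (2 * k))).eval (-2) : ℚ) : ℚ_[2]) =
      ((2 ^ (2 * k) * ρ : ℤ_[2]) : ℚ_[2]) := by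
  by_contra h
  push Not at h
  exact flat_evalAt_neg_two_ne_zero_of_even_level hSP hk hΘ h hF

omit [NeZero N] in
/-- **`a₂ = ±2` (indeed any even `a₂`): level 4 certifies when `L♯(−2) = 0`.**  `c₄ = a(a² − 4) = 0` for
`a = ±2`; with `θ₁(−2) = 0` (so `L♯(−2) = 0`) and `θ₄′(−2) ∉ 2⁴ℤ₂`, `L♭(−2) ≠ 0`. [cite: Sprung2017, Cor. 4.4] -/
theorem flat_evalAt_neg_two_ne_zero_of_level_four {a : ℤ} (ha : a = 2 ∨ a = -2) {Ls Lf : IwasawaAlgebra 2}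
    (hSP : IsSprungPair f 2 a Ls Lf) {Θ₁ Θ₄ : ℤ_[2][X]}
    (hΘ₁ : Θ₁.map (algebraMap ℤ_[2] ℚ_[2]) = (mazurTateElement f 2 1).map (algebraMap ℚ ℚ_[2]))
    (h0 : (mazurTateElement f 2 1).eval (-2) = 0)
    (hΘ₄ : Θ₄.map (algebraMap ℤ_[2] ℚ_[2]) = (mazurTateElement f 2 4).map (algebraMap ℚ ℚ_[2]))
    (hcert : ∀ ρ : ℤ_[2],
      (((derivative (mazurTateElement f 2 4)).eval (-2) : ℚ) : ℚ_[2]) ≠ ((2 ^ 4 * ρ : ℤ_[2]) : ℚ_[2])) :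
    evalAt (-2 : ℤ_[2]) Lf ≠ 0 := by
  have hS : evalAt (-2 : ℤ_[2]) Ls = 0 := sharp_evalAt_neg_two_eq_zero hSP hΘ₁ h0
  have hc4 : cSeq a 4 = 0 := by
    rw [show (4 : ℕ) = 2 + 2 from rfl, cSeq_add_two, show (2 : ℕ) + 1 = 1 + 2 from rfl, cSeq_add_two,
      cSeq_two, cSeq_one]
    rcases ha with rfl | rfl <;> norm_num
  exact flat_evalAt_neg_two_ne_zero_of_level hSP (by norm_num) hc4 (by rw [hS, mul_zero]) hΘ₄ hcert

end ImcG28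

end BlindFlat

end Summit.BirchSwinnertonDyer.Rank1Residual.Supersingular

end
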